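import Summits.CriticalPhenomena.PercolationContinuityZ3.Theorems.Transplant.SkelFrmFromBParamsFaceCountsRangeA
import Summits.CriticalPhenomena.PercolationContinuityZ3.Theorems.Transplant.SkelFrmBParamsFaceCountsRangeA
import Summits.CriticalPhenomena.PercolationContinuityZ3.Theorems.Transplant.SkelFrmFromBParamsFaceLamA
import Summits.CriticalPhenomena.PercolationContinuityZ3.Theorems.Transplant.SkelFrmBParamsFaceLamA
import Summits.CriticalPhenomena.PercolationContinuityZ3.Theorems.Transplant.SkelFrmFromBChoiceWindow
import Summits.CriticalPhenomena.PercolationContinuityZ3.Theorems.Transplant.SkelFrmBChoiceWindow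
import Summits.CriticalPhenomena.PercolationContinuityZ3.Theorems.Transplant.PlanarSkeletonFrmFromDefs
import Summits.CriticalPhenomena.PercolationContinuityZ3.Theorems.Transplant.PlanarSkeletonFrmDefs
import Summits.CriticalPhenomena.PercolationContinuityZ3.Theorems.Transplant.SkelPhiStepIDataNS
import HarnessLib
import Summits.CriticalPhenomena.PercolationContinuityZ3.Theorems.Transplant.SkelFrmBParamsFaceFloorsZXA
/-!
# U-WAVE PORT (RULING D-U, lead g21 2026-08-26; WAVE-U-MANIFEST v3.1 row «SkelFrmBParamsFaceFloorsZXA» ↦ «SkelFrmFromBParamsFaceFloorsZXA») of the tree module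
# `Transplant/SkelFrmBParamsFaceFloorsZXA` onto the carrier `PlanarSkeletonFrmFrom` (frames only, cylinders connected from width `ℓ₀` on)

ORIGINAL TITLE: (F) VALUE LAYER, N2 twin (hp-8 g42, 2026-08-23; F-DISCHARGE-MAP-N2 G18 zone floors, (Δ1)/(R-22)/E6): N1 `SkelNegBParamsFaceFloorsZXA` (p1-g14) over a generic

builds on p205010 (kernel theorem, internal audit signed; external expert review pending) — nothing in this file uses p205010; NOTHING is claimed about the
OPEN node U `SamePDropOfSkeletonFrmFrom₁` (nor U_s / the end state).  Lane `prim-bschramm`, seat `prim-bschramm-stmt` gen 26 (port pen, RULING M-11 family P-stmt; tool = p3-g26's port_u.py of record, registry-driven inputs); helper file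
(`--supports stmt-CriticalPhenomena-4575 --as helper`).  PORT RULES r1–r4 of RULING D-U: declaration order and proof texts are those of the original,
byte-identical except (i) the carrier token `PlanarSkeletonFrm ↦ PlanarSkeletonFrmFrom` (binders, `namespace`/`end` lines, qualified names of twinned
declarations), (ii) carrier-FREE declarations of the original (φ-level `Skelφ…` blocks and namespace-only arithmetic residents) are NOT re-declared —
this file imports the original and `export`s the twin-free residents (POLICY T / treatment (m1)); residents whose statement mentions a twinned
constant are copied, (iii) every carrier-binding declaration keeps its explicit binder `(Φ : PlanarSkeletonFrmFrom G)` in its own signature (r2).  Docstrings and citations are the original's.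
-/

noncomputable section

open scoped Classical

namespace Summit.CriticalPhenomena.PercolationContinuityZ3.Theorems.Transplant

namespace PlanarSkeletonFrmFrom

namespace NegB

open Literature.Probability.Percolation Literature.Probability.LatticeModels SimpleGraph
open Literature.Probability.Percolation.KozmaNitzan.Cells (oth sgOf sgOf_sign)
open SkelConc (Consts)
open Skelφ.StepI (DataN)
open TwoAxis.Para (modulus)
open Neg

namespace KS

section FloorsZ

/-- **M3 x-face field `hfR`** at the (ζ′) tuple: the habitat `flo = 5r₀ + 10u₀j + 3 − lev ≤ −kF₀A`, `kF₀A ≤ fhi = 25r₀ − 2 − lev`, and transversally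
`kF₁A ≤ 5r₁ − 7 − c 0 − |z 1 − cenS x 1|` (N2: the creep `c 0 ≤ r 1` of the staggered cells enters the transverse habitat). [cite: KozmaNitzan2024, §4 Lemma 12 (pp. 23–25)] -/
theorem hfR_XA (κ : Consts) {V : Type} [DecidableEq V] [Countable V] {G : SimpleGraph V} [G.LocallyFinite] (Φ : PlanarSkeletonFrmFrom G) (t : V) (p : unitInterval) (D : Skelφ.StepI.DataNS V) (c : ℕ) (mk : ℕ) (g : ℕ) (f : ℕ) (P : PCells2T) (hP : P.toPCells2 = fcellsA κ Φ t p D g f) (x : Site 2) (du : MDir) (hd : du.1 = 0) (j : ℕ) (hj : j < P.K) (z : Site 2) {E : ℕ} {kE : ℤ}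
    (hlev1 : P.faceL 0 j - E ≤ P.lev du x z) (hlev2 : P.lev du x z ≤ P.faceL 0 j + E)
    (hz : |z 1 - P.cenS x 1| ≤ kE) (hEu : (E : ℤ) ≤ u₀A κ Φ t p D g f)
    (hkF0 : kF₀A κ Φ t p D c mk g f ≤ 8 * u₀A κ Φ t p D g f + 1) (hkF1 : kF₁A κ Φ t p D c mk g f ≤ 8 * u₁A κ Φ t p D g f + 1)
    (hs0 : 6 * (KS0.R'0 κ Φ t p D mk : ℤ) + 11 ≤ u₀A κ Φ t p D g f) (hkE8 : kE + 8 * u₁A κ Φ t p D g f + 8 + P.c 0 ≤ 5 * (P.r 1 : ℤ)) :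
    (5 * (P.r du.1 : ℤ) + 10 * (P.s du.1 : ℤ) * j + 3 - P.lev du x z) ≤ -((fun i : Fin 2 => if i = 0 then kF₀A κ Φ t p D c mk g f else kF₁A κ Φ t p D c mk g f) du.1) ∧ ((fun i : Fin 2 => if i = 0 then kF₀A κ Φ t p D c mk g f else kF₁A κ Φ t p D c mk g f) du.1) ≤ (25 * (P.r du.1 : ℤ) - 2 - P.lev du x z) ∧ ((fun i : Fin 2 => if i = 0 then kF₀A κ Φ t p D c mk g f else kF₁A κ Φ t p D c mk g f) (oth du.1)) ≤ (5 * (P.r (oth du.1) : ℤ) - 4 - (3 : ℤ) - P.c du.1 - |z (oth du.1) - P.cenS x (oth du.1)|) := by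
  rw [hd, show oth (0 : Fin 2) = 1 from rfl]
  simp only [if_true, show ((1 : Fin 2) = 0) = False from propext ⟨fun h => absurd h (by decide), False.elim⟩, if_false]
  obtain ⟨f1, f2⟩ := faceL_bounds κ Φ t p D g f P hP j hj
  have hR0 : (0 : ℤ) ≤ (KS0.R'0 κ Φ t p D mk : ℤ) := Nat.cast_nonneg _
  have hr : (P.r 0 : ℤ) = 40 * (Neg.Kq κ : ℤ) * u₀A κ Φ t p D g f := by rw [(cells_of_hP κ Φ t p D g f P hP).1 0]; exact (units_eqA κ Φ t p D g f).2.2.1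
  have hq : (1 : ℤ) ≤ Neg.Kq κ := by exact_mod_cast Neg.one_le_Kq κ
  have es : ((P.s 0 : ℕ) : ℤ) = u₀A κ Φ t p D g f := by rw [(cells_of_hP κ Φ t p D g f P hP).2.1 0]; rfl
  have hfl : P.faceL 0 j = 5 * (P.r 0 : ℤ) + 10 * u₀A κ Φ t p D g f * ((j : ℤ) + 1) - 1 := by
    unfold PCells2.faceL; rw [es]; push_cast; ring
  rw [es]
  rw [hfl] at hlev1 hlev2
  have hu : 1 ≤ u₀A κ Φ t p D g f := (units_eqA κ Φ t p D g f).2.2.2.2.1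
  have hQu : u₀A κ Φ t p D g f ≤ (Neg.Kq κ : ℤ) * u₀A κ Φ t p D g f := le_mul_of_one_le_left (by linarith) hq
  have hz' := (abs_nonneg _).trans hz
  refine ⟨by linarith, by linarith, by linarith⟩

/-- **M3 x-face field `hZfar`** at the (ζ′) tuple: `lev + kF₀A + 1 < 20r₀ − b0TA 0` (`lev ≤ 15r₀ − 1 + E`, `kF₀A ≤ 8u₀ + 1`, `b0TA 0 = 10·Kq·u₀`,
`5r₀ = 200·Kq·u₀`). [cite: KozmaNitzan2024, §4 Lemma 12 (pp. 23–25)] -/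
theorem hZfar_XA (κ : Consts) {V : Type} [DecidableEq V] [Countable V] {G : SimpleGraph V} [G.LocallyFinite] (Φ : PlanarSkeletonFrmFrom G) (t : V) (p : unitInterval) (D : Skelφ.StepI.DataNS V) (c : ℕ) (mk : ℕ) (g : ℕ) (f : ℕ) (P : PCells2T) (hP : P.toPCells2 = fcellsA κ Φ t p D g f) (x : Site 2) (du : MDir) (hd : du.1 = 0) (j : ℕ) (hj : j < P.K) (z : Site 2) {E : ℕ}
    (hlev2 : P.lev du x z ≤ P.faceL 0 j + E) (hEu : (E : ℤ) ≤ u₀A κ Φ t p D g f)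
    (hkF0 : kF₀A κ Φ t p D c mk g f ≤ 8 * u₀A κ Φ t p D g f + 1) :
    P.lev du x z + ((fun i : Fin 2 => if i = 0 then kF₀A κ Φ t p D c mk g f else kF₁A κ Φ t p D c mk g f) du.1) + 1 < 20 * (P.r du.1 : ℤ) - ((NegB.BSlot.small κ Φ t p D g f du.1 : ℕ) : ℤ) := by
  rw [hd]
  simp only [if_true]
  obtain ⟨-, f2⟩ := faceL_bounds κ Φ t p D g f P hP j hj
  have hr : (P.r 0 : ℤ) = 40 * (Neg.Kq κ : ℤ) * u₀A κ Φ t p D g f := by rw [(cells_of_hP κ Φ t p D g f P hP).1 0]; exact (units_eqA κ Φ t p D g f).2.2.1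
  have hb : ((NegB.BSlot.small κ Φ t p D g f 0 : ℕ) : ℤ) = 30 * u₀A κ Φ t p D g f := by rw [(NegB.small_eq κ Φ t p D g f).1]; unfold u₀A; push_cast; ring
  have hq : (1 : ℤ) ≤ Neg.Kq κ := by exact_mod_cast Neg.one_le_Kq κ
  have hu : 1 ≤ u₀A κ Φ t p D g f := (units_eqA κ Φ t p D g f).2.2.2.2.1
  have hQu : u₀A κ Φ t p D g f ≤ (Neg.Kq κ : ℤ) * u₀A κ Φ t p D g f := le_mul_of_one_le_left (by linarith) hq
  rw [hb]
  linarith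

end FloorsZ

end KS

end NegB

end PlanarSkeletonFrmFrom

end Summit.CriticalPhenomena.PercolationContinuityZ3.Theorems.Transplant

end
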